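import Summits.QuantumFields.YangMills.Theorems.BalabanUVNodesN15CurvedDressedPairDefectKingTorus
import Summits.QuantumFields.YangMills.Theorems.BalabanUVNodesN15CurvedTransporterOrthogonalityUN
import HarnessLib

/-!
# Route «BalabanUVNodes» (cluster K4 «SpineRates»), Track-A DAG node N15 = NE2, BACKGROUND LAYER AT CURVED `U` — dag-n15-w3's END-TO-END TORUS STATEMENT FOR `𝔲(N)`-VALUED
# VECTOR POTENTIALS, AS PRINTED: the curved knit on King's torus pairing (`hasMaj_idef_curvDressed_kingTorus`, p595387) at the generator fields `Z′ = ad ∘ A′`, `W′ = ad ∘ B′`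
# of skew-Hermitian lattice vector potentials `A′`, `B′` in trace-form-orthonormal coordinates — the last MODEL hypothesis (skewness of the generators' coordinates) DISCHARGED and
# the (3.35)–(3.37)-shaped letters placed ON THE POTENTIALS THEMSELVES (`|A′| ≤ a`, `|∇A′| ≤ η′g`, `|∇∇A′| ≤ η′G₂` through `‖ad_X‖ ≤ 2‖X‖`)

Cell `pub-ymgap`, WIDTH SEAT `pub-ymgap-dag-n15-w2` (director-ym №197 ∕ HUMAN RULING D-0149), generation 2, file 6.  `bears_on: R4∕N15 · K3⁷ SpineGivenEndpointR13SepCoPH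
(stmt-QuantumFields-20544)`.  Filed `--kind proof --supports stmt-QuantumFields-20544 --as helper` — COUNT-NEUTRAL; three theorems (0 `def`, 0 `sorry`, 0 `instance`; Mathlib's scoped
Frobenius structure on `M_N(ℂ)` as in files 3–5); imports BY NAME dag-n15-w3 g2's file 10 `…N15CurvedDressedPairDefectKingTorus` (p595387: `hasMaj_idef_curvDressed_kingTorus`,
`torStep`, `blockMeanField`) and this seat's file 3 `…N15CurvedTransporterOrthogonalityUN` (p595427: `coordMat_adCLM_transpose_eq_neg_of_conjTranspose`); b2b `adCLM`,
`norm_adCLM_le`, `adCLM_smul`; n15-b `adCLM_sub`; nothing re-declared.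

WHY.  p595387's header: *«the curved line of seat w3 now runs from Bałaban's (3.50)–(3.53) species at a curved `U` in transporter form to the END-TO-END torus statement at
generator level»* — with, as its only remaining MODEL hypotheses, the SKEWNESS of the fine generator fields' coordinate matrices (`hZs'`, `hWs'`), and with the (3.35)∕(3.36)-shaped
letters placed on abstract generators `Z′`, `W′ : 𝔄 →L[ℝ] 𝔄`.  In the print the generators are `ad_{A′}` for a 𝔤-valued vector potential `A′` ([Balaban1985BackgroundPropagators]
(3.37) p. 396: `U′ = exp(iηA′)`, `|A′|, |∇^η_U A′| < …`; (3.50) p. 400: adjoint action).  THIS FILE is the one application that closes the line for the programme's fibre: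
`𝔄 = M_N(ℂ)`, `Z′ = ad ∘ A′`, `W′ = ad ∘ B′` with `A′`, `B′` SKEW-HERMITIAN (`𝔲(N)`-valued), coordinates `e` orthonormal for the trace form (they exist, file 3
`traceForm_exists_coords`) — skewness by file 3, and every generator letter READ OFF a letter on the potential through `‖ad_X‖ ≤ 2‖X‖` and the linearity of `ad`
(`r = 2a`, `r_B = 2b`, `g ↦ 2g_A`, `g_B ↦ 2g_B`, `G₂ ↦ 2G₂`).

WHAT: §1 ★★ `uN_hasMaj_idef_curvDressed_kingTorus` — p595387's conclusion VERBATIM at the doubled letters, hypotheses: the potentials' letters `‖A′_μ(y′)‖ ≤ a`, `‖B′_μ(y′)‖ ≤ b`,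
`‖A′_μ(y′) − A′_μ(y′ − e_ν)‖ ≤ η′g_A`, `‖B′_μ(y′) − B′_μ(y′ − e_ν)‖ ≤ η′g_B`, second differences `≤ η′G₂`, skew-Hermitian values, regimes `η₀·2a ≤ 1`, `η₀·2b ≤ 1`, and the lineage's DATA
(carrier, inductive datum on both grids with its η-defects, Neumann smallness) unchanged; §2 ★ `basisConst_le_sqrt_card_of_traceForm` (the lineage's basis constant `κ_e = ‖e‖‖e⁻¹‖` is
`≤ √|κ|` for trace-form-orthonormal coordinates — every letter explicit) and ★ `traceForm_exists_coords_basisConst` (file 3's explicit coordinates have `κ_e ≤ N√2`).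

HONEST FRAMING ∕ LIMITS.  One application + letter bookkeeping (`‖ad_X‖ ≤ 2‖X‖`); LINEARISED transport exactly as in p595387 (the coarse generator is the block MEAN of the fine
one — the lineage's stated model of Bałaban's averaging, not the non-linear (3.8)); proves NO estimate; the inductive datum ∕ carrier ∕ smallness stay DISPLAYED; [B6] gluing =
dag-n15-c's FILES 43–46; (3.35)–(3.37) p. 396, (3.50)–(3.53) p. 400, (3.63)–(3.65) pp. 402–403 cited as SHAPES ∕ MECHANISM, nothing of [B9] asserted.  NE2⁺ NOT PRINTED ∕ NOT proved
for d = 4; N15 NOT discharged; K3⁷ OPEN, not claimed; counts UNMOVED (typed 28∕28 · discharged 5∕27, A 5∕28); one finite 𝕋⁴ at fixed ε — NOT infinite volume, NOT OS on ℝ⁴, NOT a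
mass gap, NOT Clay; R4 closes the conditional finite-𝕋⁴ rung `BalabanLadder.UV` only.  Restate-immune (no Theses import).
-/

set_option autoImplicit false

noncomputable section
open scoped BigOperators Matrix Matrix.Norms.Frobenius
open Finset NormedSpace

namespace Summit.QuantumFields.YangMills.BalabanUVNodes.N15.CurvedSpecies

open Literature.MathematicalPhysics.QuantumFieldTheory.Balaban1983to89
open Literature.MathematicalPhysics.QuantumFieldTheory.Balaban1983to89.B11SectG (BlockNorm HasMaj RowSum)
open Literature.MathematicalPhysics.QuantumFieldTheory.Balaban1983to89.T4EtaRateDefect (idef)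
open Literature.MathematicalPhysics.QuantumFieldTheory.Balaban1983to89.T4EtaRateCoeffDefect (pull)
open Literature.MathematicalPhysics.QuantumFieldTheory.Balaban1983to89.B6RandomWalk (Triangle254)
open Literature.MathematicalPhysics.QuantumFieldTheory.Balaban1983to89.B5Prop11Plancherel (Tor fine)
open Literature.MathematicalPhysics.QuantumFieldTheory.King1986.Torus (blockOf)
open Literature.MathematicalPhysics.QuantumFieldTheory.Balaban1983to89.Beta.AveragingCorrectionJets (adCLM norm_adCLM_le adCLM_smul)
open Literature.Barriers.QuantumFields (traceForm)
open Summit.QuantumFields.YangMills.BalabanUVNodes.N15.MatrixSpecies (liftMap liftBlk coordMat basisConst adCLM_sub)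
open Summit.QuantumFields.YangMills.BalabanUVNodes.N15.BackgroundLayer (liftPair blkPair)
open Summit.QuantumFields.YangMills.BalabanUVNodes.N15.KingTorusLine (unitVec)

variable {d : ℕ} (L : ℕ) [NeZero L] (M : Fin d → ℕ) [hM : ∀ μ, NeZero (M μ)]
variable {n : Type} [Fintype n] [DecidableEq n] {κ : Type} [Fintype κ] [DecidableEq κ] (e : Matrix n n ℂ ≃L[ℝ] (κ → ℝ))
variable {geo : B6.Geometry} (blk : Tor M → geo.Site) (η' : ℝ) (A' B' : Fin d → Tor (fine L M) → Matrix n n ℂ)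
variable (G : (Tor M × κ → ℝ) →ₗ[ℝ] (Tor M × κ → ℝ)) (G' : (Tor (fine L M) × κ → ℝ) →ₗ[ℝ] (Tor (fine L M) × κ → ℝ))

/-- ★★ **dag-n15-w3's CURVED KNIT ON KING's TORUS PAIRING FOR `𝔲(N)`-VALUED VECTOR POTENTIALS, NO MODEL HYPOTHESIS.**  Fine torus at spacing `η′ > 0`, coarse torus at `Lη′ ≤ η₀`;
skew-Hermitian lattice vector potentials `A′_μ` (perturbation) and `B′_μ` (background) on the fine torus with the (3.35)–(3.37)-SHAPED letters ON THE POTENTIALS: `‖A′‖ ≤ a`,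
`‖B′‖ ≤ b`, `‖A′_μ(y′) − A′_μ(y′ − e_ν)‖ ≤ η′g_A`, `‖B′_μ(y′) − B′_μ(y′ − e_ν)‖ ≤ η′g_B`, second differences of `A′` `≤ η′G₂`; generators `Z′ = ad ∘ A′`, `W′ = ad ∘ B′` (their letters
`2a, 2b, 2g_A, 2g_B, 2G₂` by `‖ad_X‖ ≤ 2‖X‖`), coarse generators their block means; coordinates `e` orthonormal for the trace form (skewness of `coordMat e (ad_{A′})`,
`coordMat e (ad_{B′})` by file 3); regimes `η₀·2a ≤ 1`, `η₀·2b ≤ 1`; carrier, inductive datum (both grids, η-defects) and Neumann smallness as displayed by p595387.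
CONCLUSION: p595387's majorant for the η-defect of the dressed pairs `X̂(e^{η′ ad A′}U′)` vs `X̂(e^{η ad Ā}U)` at the doubled letters.
[cite: Balaban1985BackgroundPropagators, (3.35)–(3.37) p.396, (3.50)–(3.53) p.400, (3.63)–(3.65) pp.402–403 (shapes, mechanism)] -/
theorem uN_hasMaj_idef_curvDressed_kingTorus (he : ∀ X Y : Matrix n n ℂ, traceForm X Y = e X ⬝ᵥ e Y) (htri : Triangle254 geo) (hd : ∀ a b : geo.Site, 0 ≤ geo.dist a b) {σ cr : ℝ} (hσ : 0 ≤ σ) (hcr : 0 ≤ cr) (hrow : RowSum geo σ cr)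
    {ρ δ β m η₀ a b gA gB G₂ : ℝ} (hρ : 0 ≤ ρ) (hρδ : ρ + σ ≤ δ) (hβ : 0 ≤ β) (hm : 0 ≤ m)
    (hreg : η₀ * (2 * a) ≤ 1) (hregB : η₀ * (2 * b) ≤ 1) (hη' : 0 < η') (hηη₀ : (L : ℝ) * η' ≤ η₀)
    (ha : 0 ≤ a) (hb : 0 ≤ b) (hgA : 0 ≤ gA) (hgB : 0 ≤ gB) (hG₂ : 0 ≤ G₂)
    -- the U-layer at the curved base point, both grids, and its η-defects (entries 0∕1 of NE2⁺ at U)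
    (hG : HasMaj (BlockNorm.ofBlocks geo (liftBlk blk κ)) (BlockNorm.ofBlocks geo (liftBlk blk κ)) G (fun y y' => β * Real.exp (-(δ * geo.dist y y'))))
    (hD : ∀ j, HasMaj (BlockNorm.ofBlocks geo (liftBlk blk κ)) (BlockNorm.ofBlocks geo (liftBlk blk κ))
      (covPieces ((L : ℝ) * η') (torStep M) (gaugePair (torStep M) (expTrField e ((L : ℝ) * η') (blockMeanField L M (fun μ y' => adCLM ℝ (B' μ y'))))) G j) (fun y y' => β * Real.exp (-(δ * geo.dist y y'))))
    (hG' : HasMaj (BlockNorm.ofBlocks geo (liftBlk (blk ∘ blockOf L M) κ)) (BlockNorm.ofBlocks geo (liftBlk (blk ∘ blockOf L M) κ)) G'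
      (fun y y' => β * Real.exp (-(δ * geo.dist y y'))))
    (hD' : ∀ j, HasMaj (BlockNorm.ofBlocks geo (liftBlk (blk ∘ blockOf L M) κ)) (BlockNorm.ofBlocks geo (liftBlk (blk ∘ blockOf L M) κ))
      (covPieces η' (torStep (fine L M)) (gaugePair (torStep (fine L M)) (expTrField e η' (fun μ y' => adCLM ℝ (B' μ y')))) G' j) (fun y y' => β * Real.exp (-(δ * geo.dist y y'))))
    (hDG : HasMaj (BlockNorm.ofBlocks geo (liftBlk blk κ)) (BlockNorm.ofBlocks geo (liftBlk (blk ∘ blockOf L M) κ))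
      (idef (pull (liftMap (blockOf L M) κ)) (pull (liftMap (blockOf L M) κ)) G' G) (fun y y' => m * Real.exp (-(δ * geo.dist y y'))))
    (hDD : ∀ j, HasMaj (BlockNorm.ofBlocks geo (liftBlk blk κ)) (BlockNorm.ofBlocks geo (liftBlk (blk ∘ blockOf L M) κ))
      (idef (pull (liftMap (blockOf L M) κ)) (pull (liftMap (blockOf L M) κ)) (covPieces η' (torStep (fine L M)) (gaugePair (torStep (fine L M)) (expTrField e η' (fun μ y' => adCLM ℝ (B' μ y')))) G' j)
        (covPieces ((L : ℝ) * η') (torStep M) (gaugePair (torStep M) (expTrField e ((L : ℝ) * η') (blockMeanField L M (fun μ y' => adCLM ℝ (B' μ y'))))) G j))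
      (fun y y' => m * Real.exp (-(δ * geo.dist y y'))))
    -- (3.35)∕(3.36)-shaped letters on the FINE generator fields only
    (hA' : ∀ μ y', ‖A' μ y'‖ ≤ a) (hB' : ∀ μ y', ‖B' μ y'‖ ≤ b)
    (hgradA : ∀ μ ν y', ‖A' μ y' - A' μ (y' - unitVec (fine L M) ν)‖ ≤ η' * gA) (hgradB : ∀ μ ν y', ‖B' μ y' - B' μ (y' - unitVec (fine L M) ν)‖ ≤ η' * gB)
    (hsecA : ∀ μ ν (z' : Tor (fine L M)), ‖η'⁻¹ • (A' μ (z' + unitVec (fine L M) ν + unitVec (fine L M) μ) - A' μ (z' + unitVec (fine L M) ν)) -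
      η'⁻¹ • (A' μ (z' + unitVec (fine L M) μ) - A' μ z')‖ ≤ η' * G₂)
    (hAs : ∀ μ y', (A' μ y')ᴴ = -A' μ y') (hBs : ∀ μ y', (B' μ y')ᴴ = -B' μ y')
    -- the Neumann smallness at the generator-level row letter
    (hq : β * (expRowLetter κ (Fin d) (basisConst e) (2 * a) (2 * b) (2 * gA) * (1 + Fintype.card (Fin d ⊕ Fin d))) * cr < 1) :
    HasMaj (BlockNorm.ofBlocks geo (liftBlk blk κ)) (BlockNorm.ofBlocks geo (blkPair (liftBlk (blk ∘ blockOf L M) κ)))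
      (idef (pull (liftMap (blockOf L M) κ)) (pull (liftPair (liftMap (blockOf L M) κ)))
        (curvDressed η' (torStep (fine L M)) (expTrField e η' (fun μ y' => adCLM ℝ (B' μ y'))) (expTrField e η' (fun μ y' => adCLM ℝ (A' μ y'))) G')
        (curvDressed ((L : ℝ) * η') (torStep M) (expTrField e ((L : ℝ) * η') (blockMeanField L M (fun μ y' => adCLM ℝ (B' μ y')))) (expTrField e ((L : ℝ) * η') (blockMeanField L M (fun μ y' => adCLM ℝ (A' μ y')))) G))
      (fun y y' => (m * cr + 1 * (m * cr) * (expRowLetter κ (Fin d) (basisConst e) (2 * a) (2 * b) (2 * gA) * (1 + Fintype.card (Fin d ⊕ Fin d)) *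
          (β * (1 - β * (expRowLetter κ (Fin d) (basisConst e) (2 * a) (2 * b) (2 * gA) * (1 + Fintype.card (Fin d ⊕ Fin d))) * cr)⁻¹)) +
          β * (expFitLetter κ (Fin d) (basisConst e) (2 * a) (2 * b) (2 * gA) ((d : ℝ) * ((L : ℝ) * η') * (2 * gA))
              ((d : ℝ) * ((L : ℝ) * η') * (2 * gA) + (L : ℝ) * η' * (2 * gA))
              ((d : ℝ) * ((L : ℝ) * η') * (2 * gB) + (L : ℝ) * η' * (2 * gB)) (((d : ℝ) + 1) * ((L : ℝ) * η') * (2 * G₂)) ((L : ℝ) * η') * (1 + Fintype.card (Fin d ⊕ Fin d))) *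
            (β * (1 - β * (expRowLetter κ (Fin d) (basisConst e) (2 * a) (2 * b) (2 * gA) * (1 + Fintype.card (Fin d ⊕ Fin d))) * cr)⁻¹) * cr) *
        (1 - 1 * (β * (expRowLetter κ (Fin d) (basisConst e) (2 * a) (2 * b) (2 * gA) * (1 + Fintype.card (Fin d ⊕ Fin d))) * cr))⁻¹ * Real.exp (-(ρ * geo.dist y y'))) := by
  -- the generator-level letters READ OFF the potentials' letters through `‖ad_X‖ ≤ 2‖X‖` and the linearity of `ad`
  have h2 : ∀ {X : Matrix n n ℂ} {c : ℝ}, ‖X‖ ≤ c → ‖adCLM ℝ X‖ ≤ 2 * c := fun hX =>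
    (norm_adCLM_le ℝ _).trans (mul_le_mul_of_nonneg_left hX two_pos.le)
  have hZ' : ∀ μ y', ‖adCLM ℝ (A' μ y')‖ ≤ 2 * a := fun μ y' => h2 (hA' μ y')
  have hW' : ∀ μ y', ‖adCLM ℝ (B' μ y')‖ ≤ 2 * b := fun μ y' => h2 (hB' μ y')
  have hgrad' : ∀ μ ν y', ‖adCLM ℝ (A' μ y') - adCLM ℝ (A' μ (y' - unitVec (fine L M) ν))‖ ≤ η' * (2 * gA) := fun μ ν y' => by
    rw [adCLM_sub, mul_left_comm]; exact h2 (hgradA μ ν y')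
  have hgradW' : ∀ μ ν y', ‖adCLM ℝ (B' μ y') - adCLM ℝ (B' μ (y' - unitVec (fine L M) ν))‖ ≤ η' * (2 * gB) := fun μ ν y' => by
    rw [adCLM_sub, mul_left_comm]; exact h2 (hgradB μ ν y')
  have hsec' : ∀ μ ν (z' : Tor (fine L M)), ‖η'⁻¹ • (adCLM ℝ (A' μ (z' + unitVec (fine L M) ν + unitVec (fine L M) μ)) - adCLM ℝ (A' μ (z' + unitVec (fine L M) ν))) -
      η'⁻¹ • (adCLM ℝ (A' μ (z' + unitVec (fine L M) μ)) - adCLM ℝ (A' μ z'))‖ ≤ η' * (2 * G₂) := fun μ ν z' => by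
    rw [adCLM_sub, adCLM_sub, ← adCLM_smul, ← adCLM_smul, adCLM_sub, mul_left_comm]; exact h2 (hsecA μ ν z')
  have hZs' : ∀ μ y', (coordMat e (adCLM ℝ (A' μ y')))ᵀ = -coordMat e (adCLM ℝ (A' μ y')) := fun μ y' =>
    coordMat_adCLM_transpose_eq_neg_of_conjTranspose e he (hAs μ y')
  have hWs' : ∀ μ y', (coordMat e (adCLM ℝ (B' μ y')))ᵀ = -coordMat e (adCLM ℝ (B' μ y')) := fun μ y' =>
    coordMat_adCLM_transpose_eq_neg_of_conjTranspose e he (hBs μ y')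
  exact hasMaj_idef_curvDressed_kingTorus L M e blk η' (fun μ y' => adCLM ℝ (A' μ y')) (fun μ y' => adCLM ℝ (B' μ y')) G G' htri hd hσ hcr hrow hρ hρδ hβ hm hreg hregB hη' hηη₀
    (by positivity) (by positivity) (by positivity) (by positivity) (by positivity) hG hD hG' hD' hDG hDD hZ' hW' hgrad' hgradW' hsec' hZs' hWs' hq


/-! ## §2 The basis constant of trace-form-orthonormal coordinates is explicit: `κ_e ≤ √|κ|` (`= N√2` for the coordinates `(Re X_{ij}, Im X_{ij})`) -/

section BasisConst

open Literature.Barriers.QuantumFields (traceForm_self)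

variable {n : Type} [Fintype n] [DecidableEq n] {κ : Type} [Fintype κ] (e : Matrix n n ℂ ≃L[ℝ] (κ → ℝ))

/-- ★ **THE BASIS CONSTANT `κ_e = ‖e‖·‖e⁻¹‖` OF TRACE-FORM-ORTHONORMAL COORDINATES IS AT MOST `√|κ|`**: `‖e X‖_∞ ≤ ‖X‖_F` (each coordinate is dominated by the Euclidean norm
`‖X‖_F² = Σ_k (e X)_k²`, the tree's `traceForm_self`) and `‖e⁻¹ v‖_F² = Σ_k v_k² ≤ |κ|·‖v‖_∞²` — so every letter `κ_e·(…)` of the lineage (`p = κ_e e r`, `q`, `expRowLetter`,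
`expFitLetter`) is EXPLICIT for `𝔲(N)`-valued data. [folklore] -/
theorem basisConst_le_sqrt_card_of_traceForm (he : ∀ X Y : Matrix n n ℂ, traceForm X Y = e X ⬝ᵥ e Y) :
    basisConst e ≤ Real.sqrt (Fintype.card κ) := by
  unfold basisConst
  refine (mul_le_mul ?_ ?_ (norm_nonneg _) zero_le_one).trans_eq (one_mul _)
  · refine ContinuousLinearMap.opNorm_le_bound _ zero_le_one fun X => ?_
    rw [one_mul, ContinuousLinearEquiv.coe_coe, pi_norm_le_iff_of_nonneg (norm_nonneg X)]
    intro k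
    have hsq : ‖X‖ ^ 2 = ∑ k, e X k * e X k := by rw [← traceForm_self, he]; rfl
    have hk : (e X k) ^ 2 ≤ ‖X‖ ^ 2 := by
      rw [hsq, sq]
      exact Finset.single_le_sum (f := fun k => e X k * e X k) (fun k _ => mul_self_nonneg _) (Finset.mem_univ k)
    rw [Real.norm_eq_abs]
    exact abs_le.mpr (abs_le_of_sq_le_sq' hk (norm_nonneg X))
  · refine ContinuousLinearMap.opNorm_le_bound _ (Real.sqrt_nonneg _) fun v => ?_
    rw [ContinuousLinearEquiv.coe_coe]
    have hsq : ‖e.symm v‖ ^ 2 = ∑ k, v k * v k := by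
      rw [← traceForm_self, he, ContinuousLinearEquiv.apply_symm_apply]; rfl
    have hle : ‖e.symm v‖ ^ 2 ≤ (Real.sqrt (Fintype.card κ) * ‖v‖) ^ 2 := by
      rw [hsq, mul_pow, Real.sq_sqrt (Nat.cast_nonneg _)]
      calc ∑ k, v k * v k ≤ ∑ _k : κ, ‖v‖ ^ 2 := Finset.sum_le_sum fun k _ => by
              have h := norm_le_pi_norm v k
              rw [Real.norm_eq_abs] at h
              nlinarith [abs_nonneg (v k), sq_abs (v k)]
        _ = (Fintype.card κ : ℝ) * ‖v‖ ^ 2 := by rw [Finset.sum_const, Finset.card_univ, nsmul_eq_mul]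
    exact (abs_le_of_sq_le_sq' hle (by positivity)).2

/-- ★ **EXPLICIT COORDINATES WITH AN EXPLICIT BASIS CONSTANT**: the coordinates `X ↦ (Re X_{ij}, Im X_{ij})` of file 3 (`traceForm_exists_coords`) are trace-form-orthonormal with
`κ_e ≤ √(2N²) = N√2` — so §1's statement, read in these coordinates, has all its letters explicit in `N`, `a`, `b`, `g_A`, `g_B`, `G₂`, `η′`, `L`, `d`. [folklore] -/
theorem traceForm_exists_coords_basisConst :
    ∃ e : Matrix n n ℂ ≃L[ℝ] (n × n × Fin 2 → ℝ), (∀ X Y : Matrix n n ℂ, traceForm X Y = e X ⬝ᵥ e Y) ∧ basisConst e ≤ Real.sqrt (2 * (Fintype.card n : ℝ) ^ 2) := by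
  obtain ⟨e, he⟩ := traceForm_exists_coords (n := n)
  refine ⟨e, he, (basisConst_le_sqrt_card_of_traceForm e he).trans_eq ?_⟩
  congr 1
  simp only [Fintype.card_prod, Fintype.card_fin, Nat.cast_mul, Nat.cast_ofNat]
  ring

end BasisConst

end Summit.QuantumFields.YangMills.BalabanUVNodes.N15.CurvedSpecies

end
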